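import Summits.ABC.IUTFork.Conditional.WRowHexLamSevenTriplesSixteen
import Summits.ABC.IUTFork.Conditional.WRowUnconditionalCellsSlot
import HarnessLib

/-!
# R-W WINDOW numerics («W:HEX-AXIS-REST», `k = 16`, part (C)) — the ARITHMETIC `hcell` of the inhabited band `l ≥ 329281` of the HEX class `k = 16`:
# the slot socket's cells at every bad prime of `(7¹⁶ + 4)·(7¹⁶ − 4)·2·7¹⁶`, uniformly in the prime level `l`

PROOF-ONLY file (D-0012; 0 definitions, 0 `Prop` facts) of the abc-iut cell — branch C certificate seat abc-iut-C-cert-1 (gen 8), row «W:HEX-AXIS-REST»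
(abc-iut-plan C-R105 (b)), GENERATED with abc-iut-w5-d107 gen 9's «W:HEX-INHABITED-BANDS» generator gen_hex.py (HOME/staging/W/w5-d107/gen9/; config k = 16,
A₇ = 7, L0 = 329281, exact level 329281) — the text below is theirs in shape, credited line by line; the arithmetic `WRow.hcell_lamSeven_sixteen_all` lives in
`WRowHexLamSevenSixteenCells.lean`, the band theorems in `WRowHexLamSevenSixteenAllLevels.lean`. The R-W numerics lead's table of record
(HOME/plan/rescue/R-W/WINDOW-TABLE.tsv v4.42) has NO `k = 16` row at these levels (beyond the table); BY NAME the REFUTED side covers every prime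
`11 ≤ l ≤ 329269` (W-neg-2 `HexRad.…_rad_eleven` ≤ 479 · this seat's `WRowHexLamSevenSixteenRefutedBand` 481–329269); this band is every prime
`l ≥ 329281` (floor-free from 329287; `l = 329281` by the exact top-label cell `WRow.hexcell_sixteen_small`) (two desks agree: this seat's slot-model check and abc-iut-W-num-5 g5's engine C, STATUS 07:20:50Z). This file decides them on the INHABITED side by ONE theorem. KEY REMARK: `λ_16 = (7¹⁶ + 4)/(2·7¹⁶) =
33232930569605/66465861139202` is the Frey–Legendre point `a/c` of the abc triple `33232930569605 + 33232930569597 = 66465861139202` (`gcd = 1`: both summands odd, difference `8`), so abc-iut-W-row-1's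
INTEGER-SLOT triple socket `WRow.licence_triple_unconditional_slot` (`Cor312LicenceTripleUnconditionalSlot`, inner radius `max(1, ⌊e/(p−1)⌋)` at every
odd bad prime) applies VERBATIM at a SYMBOLIC level `l`; its arithmetic hypothesis `hcell` is discharged uniformly in `l` — per bad prime `p` of
`abc = 2 · 3 · 5 · 7¹⁶ · 11² · 13 · 15881 · 443077 · 1153921 · 5764799` the admissible ramification indices are `e = m_p·l·n`, `e` is off the cyclotomic indices, and with ONE fixed
envelope exponent per prime (A_3 = 0, A_5 = 0, A_7 = 7, A_11 = 1, A_13 = 0, A_15881 = 0, A_443077 = 0, A_1153921 = 0, A_5764799 = 0) the two floor-free END-LABEL cells (`WRow.cell_wild_of_ends` p485154 / `WRow.cell_tameslot_of_ends`) are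
quadratics in `(l−1)/2` settled by `nlinarith`; the result is then TRANSPORTED from the carrier `ratPoint (33232930569605/66465861139202)` to the table's carrier
`ratPoint ((2 : ℚ)⁻¹ + 2/7^16)` (`lamSeven_eq_hex16`). Nothing of abc-iut-W-row-1 / W-neg-1 / W-neg-2 / c312-5 / w4-d094 is restated: consumed BY NAME
through the socket. TAKES NO SIDE on [IUTchIII] Cor. 3.12 (S. Mochizuki, *Inter-universal Teichmüller theory III*, Cor. 3.12 p. 173–174; Step (xi-f)
p. 184) or on any author; «inhabited as typed» ≠ «asserted in print».

WHAT IS PROVED (namespace `Summit.ABC.IUTFork.Conditional`): `isABCTriple_hex16`, `lamSeven_eq_hex16`, `eq_of_prime_dvd_triple_hex16`, `factorization_triple_hex16`,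
`WRow.hcell_lamSeven_sixteen_all` (the arithmetic, every prime `l ≥ 329281`), **`WRow.licence_lamSeven_sixteen_all`** — for `k = 16`, EVERY prime `l ≥ 329281`, EVERY genuine
Θ-volume datum `T` at `(ratPoint (1/2 + 2/7^k), l)` and EVERY pair of realising Θ- and q-ideles, abc-iut-c312-1's `Thm311ToCor312.Licence` HOLDS at
`settingPrVolSharp (pilotDataOfK T.D T.K) …`; **`WRow.exists_qPinned_and_hull_lamSeven_sixteen_all`** — branch C's «∃ ρ qK, QPinned ∧ PilotKummerCompatHull» there, any
columns. READING (neutral; numbers, not adjectives): the per-datum S_H object of the window certificates' binders (`hSHw` p447945 / `hSHwBad` p453137) is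
INHABITED at the whole datum class `(λ_16, l)` for every prime `l ≥ 329281`; no number-level and no local-type hypothesis is consumed. Admissibility / (P6) /
Szpiro-badness of `(ratPoint λ_16, l)` and NON-EMPTINESS of the datum type are NOT claimed. HONEST SCOPE: OUR sharp containers; STRONGER-THAN-PRINT hull
reading; nothing about the printed inequality or any author's intended hull; typed ≠ proved; instantiated ≠ endorsed; no abc claim.
[cite: Mochizuki2012, IUTchI Def. 3.1 (b),(c) pp. 61–62, Rmk. 3.1.5 p. 65, Ex. 3.2 (iv) p. 71; IUTchIII Cor. 3.12 Step (xi-f) p. 184; IUTchIV Prop. 1.1 p. 9, Prop. 1.2 (i)(ii) p. 10, Prop. 1.4 (ii) p. 13, Cor. 2.2 (ii) proof (P5) p. 46]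
[cite: DupuyHilado2025, §3.3, §3.4, §4.9, §4.12] [cite: NeukirchANT1999, Ch. II (5.5)–(5.7)] [claim: Mochizuki2012, status: disputed] for every IUT sentence.
-/

noncomputable section

open Set Function Metric NumberField IsDedekindDomain

namespace Summit.ABC.IUTFork.Conditional

open Thm311 Thm311.Real Cor312 Cor312Vol Cor312Prov Literature.IUT.LogThetaLattice Literature.IUT.LogVolume
  Literature.IUT.HodgeTheaters Literature.IUT.LogVolume.Cor22
open Literature.NumberTheory.NumberFields Literature.NumberTheory.GaloisRepresentations.Ultrametric
open Literature.NumberTheory.DiophantineGeometry Literature.NumberTheory.DiophantineGeometry.GenEll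


/-! ## The exact cells at `l = 329281` (below the floor-free threshold `329287` of the `p = 7` branch) -/

/-- **The exact integer cells at `p = 7` for `k = 16` at the single level `l = 329281`** (below the floor-free threshold of the `p = 7` branch; `e = 15·l·n`,
exponents `7`/`8`, slot `⌊e/6⌋`): for `n = 1` only the TOP label needs the floor (one `decide`; the labels below by the floor-free ends at `n₀ = 1` on
`L = 164639`), every `n ≥ 2` by the floor-free base cell at `n₀ = 2` (`WRow.cell_tameslot_of_ends`). Desk: this seat's slot-model check = abc-iut-W-num-5 g5 engine C. [folklore] -/
theorem WRow.hexcell_sixteen_small {l : ℕ} (hl : l = 329281) {n : ℕ} (hn : 1 ≤ n) {i : ℕ} (hi : i < (l - 1) / 2) :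
    ((15 * l * n : ℕ) : ℤ) * ((((i + 1 : ℕ) : ℤ) ^ 2 * ((15 * l * n * (2 * 16) / (2 * l) : ℕ) : ℤ) -
            ((i + 1 : ℕ) : ℤ) * (((15 * l * n - 1 : ℕ) : ℕ) : ℤ) -
            ((i + 2 : ℕ) : ℤ) * ((((max 1 (15 * l * n / (7 - 1))) : ℕ) : ℤ))) / ((15 * l * n : ℕ) : ℤ)) +
          ((i + 2 : ℕ) : ℤ) * min (((7 : ℕ) : ℤ) ^ 7 - ((7 : ℕ) : ℤ) * ((15 * l * n : ℕ) : ℤ))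
            (((7 : ℕ) : ℤ) ^ 8 - ((8 : ℕ) : ℤ) * ((15 * l * n : ℕ) : ℤ)) ≤
        ((15 * l * n * (2 * 16) / (2 * l) : ℕ) : ℤ) := by
  subst hl
  rcases Nat.lt_or_ge n 2 with hn2 | hn2
  · obtain rfl : n = 1 := by omega
    rcases Nat.lt_or_ge i 164639 with hi' | hi'
    · refine WRow.cell_tameslot_of_ends ((7 : ℕ) : ℤ) (15 * 329281) (7 - 1) 823202 (2 * 16) (2 * 329281) 7 8 164639 1 (by norm_num) (by norm_num) (by norm_num)
        (by norm_num) (by norm_num) (by norm_num) (by norm_num) ?_ hi' (le_refl 1)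
      rintro i (rfl | hi'')
      · norm_num
      · obtain rfl : i = 164638 := by omega
        norm_num
    · norm_num at hi
      obtain rfl : i = 164639 := by omega
      decide +kernel
  · refine WRow.cell_tameslot_of_ends ((7 : ℕ) : ℤ) (15 * 329281) (7 - 1) 823202 (2 * 16) (2 * 329281) 7 8 164640 2 (by norm_num) (by norm_num) (by norm_num)
      (by norm_num) (by norm_num) (by norm_num) (by norm_num) ?_ hi hn2
    rintro i (rfl | hi')
    · norm_num
    · obtain rfl : i = 164639 := by omega
      norm_num

/-! ## The arithmetic at a symbolic prime level `l ≥ 329281` -/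

/-- **The slot socket's arithmetic hypothesis `hcell` for `(33232930569605, 33232930569597, 66465861139202)` at EVERY prime level `l ≥ 329281`.** Per prime of `abc` other than `2, l`:
the divisibilities the socket hands over force `e = m_p·l·n` (`n ≥ 1`), `e` is off the cyclotomic indices, and with the fixed exponents
A_3 = 0, A_5 = 0, A_7 = 7, A_11 = 1, A_13 = 0, A_15881 = 0, A_443077 = 0, A_1153921 = 0, A_5764799 = 0 the two end-label floor-free cells (inner radius `⌊e/(p−1)⌋` at the wild `3, 5`, the integer slot `⌊e/6⌋` at `7`, the volume
witness elsewhere) are quadratics in `(l−1)/2` with the sign settled by `nlinarith`; all labels and multiples by `WRow.cell_wild_of_ends` /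
`WRow.cell_tameslot_of_ends`. [folklore] -/
theorem WRow.hcell_lamSeven_sixteen_all {l : ℕ} (hl : l.Prime) (hl0 : 329281 ≤ l) :
    ∀ p : ℕ, p.Prime → p ∣ 33232930569605 * 33232930569597 * 66465861139202 → p ≠ 2 → p ≠ l → ∀ e : ℕ, 0 < e → l ∣ e →
      15 * l ∣ e * (33232930569605 * 33232930569597 * 66465861139202).factorization p → (p ∣ 30 → (p - 1) ∣ e) →
      (p ∣ 66465861139202 → Odd ((33232930569605 * 33232930569597 * 66465861139202).factorization p) → 30 * l ∣ e * (33232930569605 * 33232930569597 * 66465861139202).factorization p) →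
      (∀ k : ℕ, (e : ℤ) ≠ (p : ℤ) ^ k * ((p : ℤ) - 1)) ∧
      ∀ i : ℕ, i < (l - 1) / 2 →
        (e : ℤ) * ((((i + 1 : ℕ) : ℤ) ^ 2 * ((e * (2 * (33232930569605 * 33232930569597 * 66465861139202).factorization p) / (2 * l) : ℕ) : ℤ) -
            ((i + 1 : ℕ) : ℤ) * (((if p ∣ 30 ∧ ¬ p ∣ (33232930569605 * 33232930569597 * 66465861139202).factorization p then 2 * e - 1 else e - 1 : ℕ) : ℕ) : ℤ) -
            ((i + 2 : ℕ) : ℤ) * ((((max 1 (e / (p - 1))) : ℕ) : ℤ))) / (e : ℤ)) +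
          ((i + 2 : ℕ) : ℤ) * min ((p : ℤ) ^ (if p = 7 then 7 else if p = 11 then 1 else 0) - ((if p = 7 then 7 else if p = 11 then 1 else 0 : ℕ) : ℤ) * (e : ℤ))
            ((p : ℤ) ^ (if p = 7 then 8 else if p = 11 then 2 else 1) - ((if p = 7 then 8 else if p = 11 then 2 else 1 : ℕ) : ℤ) * (e : ℤ)) ≤
        ((e * (2 * (33232930569605 * 33232930569597 * 66465861139202).factorization p) / (2 * l) : ℕ) : ℤ) := by
  intro p hp hpabc h2 hpl e he _hle h15 h30 hodd
  rcases eq_of_prime_dvd_triple_hex16 hp hpabc with rfl | rfl | rfl | rfl | rfl | rfl | rfl | rfl | rfl | rfl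
  · exact absurd rfl h2
  · -- `p = 3`: `v_3(abc) = 1`, admissible `e = 30·l·n`, `A = 0`, shape wild
    rw [factorization_triple_hex16.1] at h15 hodd ⊢
    have hA : 15 * l ∣ e := by simpa using h15
    have hq : 2 ∣ e := by have := h30 (by norm_num); norm_num at this; exact this
    have hcopq : Nat.Coprime 2 (15 * l) :=
      Nat.Coprime.mul_right (by norm_num) ((Nat.coprime_primes (by norm_num) hl).mpr (by omega))
    have he0 : 30 * l ∣ e := by
      have := Nat.Coprime.mul_dvd_of_dvd_of_dvd hcopq hq hA; rwa [← mul_assoc, show (2 : ℕ) * 15 = 30 by norm_num] at this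
    obtain ⟨n, rfl⟩ := he0
    have hn : 1 ≤ n := Nat.pos_of_ne_zero (by rintro rfl; simp at he)
    refine ⟨WRow.natCast_ne_pow_mul_sub_one (by norm_num : Nat.Prime 5) (by norm_num) (by norm_num) (by norm_num)
      ⟨6 * l * n, by ring⟩, fun i hi => ?_⟩
    have hmax : 1 ≤ 30 * l * n / (3 - 1) := (Nat.le_div_iff_mul_le (by norm_num)).mpr (by nlinarith)
    rw [if_pos ⟨by norm_num, by norm_num⟩, max_eq_right hmax]
    simp only [show ((3 : ℕ) = 7) = False from eq_false (by decide), show ((3 : ℕ) = 11) = False from eq_false (by decide), ite_false]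
    refine WRow.cell_wild_of_ends ((3 : ℕ) : ℤ) (30 * l) (3 - 1) (2 * 1) (2 * l) 0 1 ((l - 1) / 2) (by norm_num) (by norm_num)
      (Dvd.dvd.mul_right (by norm_num) l) (by omega) ⟨30, by ring⟩ (by omega) ?_ hi hn
    have hP : 30 * l * (2 * 1) / (2 * l) = 30 := Nat.div_eq_of_eq_mul_left (by omega) (by ring)
    have hR : 30 * l / (3 - 1) = 15 * l := by omega
    have hpA : (((3 : ℕ) : ℤ)) ^ 0 = 1 := by norm_num
    rintro i (rfl | hi')
    · rw [hP, hR, hpA]; push_cast; omega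
    · obtain ⟨k, hk⟩ := hl.odd_of_ne_two (by omega)
      have hl' : l = 2 * i + 3 := by omega
      subst hl'
      have hi0 : ((164639 : ℕ) : ℤ) ≤ (i : ℤ) := by exact_mod_cast (show 164639 ≤ i by omega)
      rw [hP, hR, hpA]; push_cast at hi0 ⊢
      nlinarith [sq_nonneg (i : ℤ), mul_nonneg (sub_nonneg.mpr hi0) (show (0 : ℤ) ≤ (i : ℤ) by positivity)]
  · -- `p = 5`: `v_5(abc) = 1`, admissible `e = 60·l·n`, `A = 0`, shape wild
    rw [factorization_triple_hex16.2.1] at h15 hodd ⊢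
    have hA : 15 * l ∣ e := by simpa using h15
    have hq : 4 ∣ e := by have := h30 (by norm_num); norm_num at this; exact this
    have hcopq : Nat.Coprime 4 (15 * l) :=
      Nat.Coprime.mul_right (by norm_num) (by simpa using ((Nat.coprime_primes (by norm_num) hl).mpr (by omega) : Nat.Coprime 2 l).pow_left 2)
    have he0 : 60 * l ∣ e := by
      have := Nat.Coprime.mul_dvd_of_dvd_of_dvd hcopq hq hA; rwa [← mul_assoc, show (4 : ℕ) * 15 = 60 by norm_num] at this
    obtain ⟨n, rfl⟩ := he0
    have hn : 1 ≤ n := Nat.pos_of_ne_zero (by rintro rfl; simp at he)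
    refine ⟨WRow.natCast_ne_pow_mul_sub_one (by norm_num : Nat.Prime 3) (by norm_num) (by norm_num) (by norm_num)
      ⟨20 * l * n, by ring⟩, fun i hi => ?_⟩
    have hmax : 1 ≤ 60 * l * n / (5 - 1) := (Nat.le_div_iff_mul_le (by norm_num)).mpr (by nlinarith)
    rw [if_pos ⟨by norm_num, by norm_num⟩, max_eq_right hmax]
    simp only [show ((5 : ℕ) = 7) = False from eq_false (by decide), show ((5 : ℕ) = 11) = False from eq_false (by decide), ite_false]
    refine WRow.cell_wild_of_ends ((5 : ℕ) : ℤ) (60 * l) (5 - 1) (2 * 1) (2 * l) 0 1 ((l - 1) / 2) (by norm_num) (by norm_num)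
      (Dvd.dvd.mul_right (by norm_num) l) (by omega) ⟨60, by ring⟩ (by omega) ?_ hi hn
    have hP : 60 * l * (2 * 1) / (2 * l) = 60 := Nat.div_eq_of_eq_mul_left (by omega) (by ring)
    have hR : 60 * l / (5 - 1) = 15 * l := by omega
    have hpA : (((5 : ℕ) : ℤ)) ^ 0 = 1 := by norm_num
    rintro i (rfl | hi')
    · rw [hP, hR, hpA]; push_cast; omega
    · obtain ⟨k, hk⟩ := hl.odd_of_ne_two (by omega)
      have hl' : l = 2 * i + 3 := by omega
      subst hl'
      have hi0 : ((164639 : ℕ) : ℤ) ≤ (i : ℤ) := by exact_mod_cast (show 164639 ≤ i by omega)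
      rw [hP, hR, hpA]; push_cast at hi0 ⊢
      nlinarith [sq_nonneg (i : ℤ), mul_nonneg (sub_nonneg.mpr hi0) (show (0 : ℤ) ≤ (i : ℤ) by positivity)]
  · -- `p = 7`: `v_7(abc) = 16`, admissible `e = 15·l·n`, `A = 7`, shape tame
    rw [factorization_triple_hex16.2.2.1] at h15 hodd ⊢
    have hcopv : Nat.Coprime (15 * l) 16 :=
      Nat.Coprime.mul_left (by norm_num) ((Nat.Prime.coprime_iff_not_dvd hl).mpr (fun h => by have := Nat.le_of_dvd (by norm_num) h; omega))
    have hA : 15 * l ∣ e := hcopv.dvd_of_dvd_mul_right h15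
    obtain ⟨n, rfl⟩ := hA
    have hn : 1 ≤ n := Nat.pos_of_ne_zero (by rintro rfl; simp at he)
    refine ⟨WRow.natCast_ne_pow_mul_sub_one (by norm_num : Nat.Prime 5) (by norm_num) (by norm_num) (by norm_num)
      ⟨3 * l * n, by ring⟩, fun i hi => ?_⟩
    rw [if_neg (by norm_num : ¬ ((7 : ℕ) ∣ 30 ∧ ¬ (7 : ℕ) ∣ 16))]
    simp only [ite_true]
    by_cases hthr : 329287 ≤ l
    swap
    · exact WRow.hexcell_sixteen_small (l := l) (by interval_cases l <;> first | rfl | (exact absurd hl (by norm_num))) hn hi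
    · refine WRow.cell_tameslot_of_ends ((7 : ℕ) : ℤ) (15 * l) (7 - 1) (15 * l / 6) (2 * 16) (2 * l) 7 8 ((l - 1) / 2) 1 (by norm_num) (by norm_num)
        (by omega) (by omega) ⟨240, by ring⟩ (by omega) le_rfl ?_ hi hn
      have hP : 15 * l * (2 * 16) / (2 * l) = 240 := Nat.div_eq_of_eq_mul_left (by omega) (by ring)
      have hpA : (((7 : ℕ) : ℤ)) ^ 7 = 823543 := by norm_num
      rintro i (rfl | hi')
      · rw [hP, hpA]; push_cast; omega
      · obtain ⟨k, hk⟩ := hl.odd_of_ne_two (by omega)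
        have hl' : l = 2 * i + 3 := by omega
        subst hl'
        have hi0 : ((164642 : ℕ) : ℤ) ≤ (i : ℤ) := by exact_mod_cast (show 164642 ≤ i by omega)
        have hr' : 15 * (2 * i + 3) ≤ 6 * (15 * (2 * i + 3) / 6) + 5 := by omega
        generalize 15 * (2 * i + 3) / 6 = ρ at hr' ⊢
        have hr'' : (15 : ℤ) * (2 * (i : ℤ) + 3) ≤ 6 * (ρ : ℤ) + 5 := by exact_mod_cast hr'
        rw [hP, hpA]; push_cast at hi0 ⊢
        nlinarith [sq_nonneg (i : ℤ), mul_nonneg (sub_nonneg.mpr hi0) (show (0 : ℤ) ≤ (i : ℤ) by positivity),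
          mul_le_mul_of_nonneg_left hr'' (show (0 : ℤ) ≤ (i : ℤ) + 2 by positivity)]
  · -- `p = 11`: `v_11(abc) = 2`, admissible `e = 15·l·n`, `A = 1`, shape tame
    rw [factorization_triple_hex16.2.2.2.1] at h15 hodd ⊢
    have hcopv : Nat.Coprime (15 * l) 2 :=
      Nat.Coprime.mul_left (by norm_num) ((Nat.Prime.coprime_iff_not_dvd hl).mpr (fun h => by have := Nat.le_of_dvd (by norm_num) h; omega))
    have hA : 15 * l ∣ e := hcopv.dvd_of_dvd_mul_right h15
    obtain ⟨n, rfl⟩ := hA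
    have hn : 1 ≤ n := Nat.pos_of_ne_zero (by rintro rfl; simp at he)
    refine ⟨WRow.natCast_ne_pow_mul_sub_one (by norm_num : Nat.Prime 3) (by norm_num) (by norm_num) (by norm_num)
      ⟨5 * l * n, by ring⟩, fun i hi => ?_⟩
    rw [if_neg (by norm_num : ¬ ((11 : ℕ) ∣ 30 ∧ ¬ (11 : ℕ) ∣ 2))]
    simp only [show ((11 : ℕ) = 7) = False from eq_false (by decide), ite_true, ite_false]
    refine WRow.cell_tameslot_of_ends ((11 : ℕ) : ℤ) (15 * l) (11 - 1) 0 (2 * 2) (2 * l) 1 2 ((l - 1) / 2) 1 (by norm_num) (by norm_num)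
      (by omega) (by omega) ⟨30, by ring⟩ (by omega) le_rfl ?_ hi hn
    have hP : 15 * l * (2 * 2) / (2 * l) = 30 := Nat.div_eq_of_eq_mul_left (by omega) (by ring)
    have hpA : (((11 : ℕ) : ℤ)) ^ 1 = 11 := by norm_num
    rintro i (rfl | hi')
    · rw [hP, hpA]; push_cast; omega
    · obtain ⟨k, hk⟩ := hl.odd_of_ne_two (by omega)
      have hl' : l = 2 * i + 3 := by omega
      subst hl'
      have hi0 : ((164639 : ℕ) : ℤ) ≤ (i : ℤ) := by exact_mod_cast (show 164639 ≤ i by omega)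
      rw [hP, hpA]; push_cast at hi0 ⊢
      nlinarith [sq_nonneg (i : ℤ), mul_nonneg (sub_nonneg.mpr hi0) (show (0 : ℤ) ≤ (i : ℤ) by positivity)]
  · -- `p = 13`: `v_13(abc) = 1`, admissible `e = 15·l·n`, `A = 0`, shape tame
    rw [factorization_triple_hex16.2.2.2.2.1] at h15 hodd ⊢
    have hA : 15 * l ∣ e := by simpa using h15
    obtain ⟨n, rfl⟩ := hA
    have hn : 1 ≤ n := Nat.pos_of_ne_zero (by rintro rfl; simp at he)
    refine ⟨WRow.natCast_ne_pow_mul_sub_one (by norm_num : Nat.Prime 5) (by norm_num) (by norm_num) (by norm_num)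
      ⟨3 * l * n, by ring⟩, fun i hi => ?_⟩
    rw [if_neg (by norm_num : ¬ ((13 : ℕ) ∣ 30 ∧ ¬ (13 : ℕ) ∣ 1))]
    simp only [show ((13 : ℕ) = 7) = False from eq_false (by decide), show ((13 : ℕ) = 11) = False from eq_false (by decide), ite_false]
    refine WRow.cell_tameslot_of_ends ((13 : ℕ) : ℤ) (15 * l) (13 - 1) 0 (2 * 1) (2 * l) 0 1 ((l - 1) / 2) 1 (by norm_num) (by norm_num)
      (by omega) (by omega) ⟨15, by ring⟩ (by omega) le_rfl ?_ hi hn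
    have hP : 15 * l * (2 * 1) / (2 * l) = 15 := Nat.div_eq_of_eq_mul_left (by omega) (by ring)
    have hpA : (((13 : ℕ) : ℤ)) ^ 0 = 1 := by norm_num
    rintro i (rfl | hi')
    · rw [hP, hpA]; push_cast; omega
    · obtain ⟨k, hk⟩ := hl.odd_of_ne_two (by omega)
      have hl' : l = 2 * i + 3 := by omega
      subst hl'
      have hi0 : ((164639 : ℕ) : ℤ) ≤ (i : ℤ) := by exact_mod_cast (show 164639 ≤ i by omega)
      rw [hP, hpA]; push_cast at hi0 ⊢
      nlinarith [sq_nonneg (i : ℤ), mul_nonneg (sub_nonneg.mpr hi0) (show (0 : ℤ) ≤ (i : ℤ) by positivity)]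
  · -- `p = 15881`: `v_15881(abc) = 1`, admissible `e = 15·l·n`, `A = 0`, shape tame
    rw [factorization_triple_hex16.2.2.2.2.2.1] at h15 hodd ⊢
    have hA : 15 * l ∣ e := by simpa using h15
    obtain ⟨n, rfl⟩ := hA
    have hn : 1 ≤ n := Nat.pos_of_ne_zero (by rintro rfl; simp at he)
    refine ⟨WRow.natCast_ne_pow_mul_sub_one (by norm_num : Nat.Prime 3) (by norm_num) (by norm_num) (by norm_num)
      ⟨5 * l * n, by ring⟩, fun i hi => ?_⟩
    rw [if_neg (by norm_num : ¬ ((15881 : ℕ) ∣ 30 ∧ ¬ (15881 : ℕ) ∣ 1))]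
    simp only [show ((15881 : ℕ) = 7) = False from eq_false (by decide), show ((15881 : ℕ) = 11) = False from eq_false (by decide), ite_false]
    refine WRow.cell_tameslot_of_ends ((15881 : ℕ) : ℤ) (15 * l) (15881 - 1) 0 (2 * 1) (2 * l) 0 1 ((l - 1) / 2) 1 (by norm_num) (by norm_num)
      (by omega) (by omega) ⟨15, by ring⟩ (by omega) le_rfl ?_ hi hn
    have hP : 15 * l * (2 * 1) / (2 * l) = 15 := Nat.div_eq_of_eq_mul_left (by omega) (by ring)
    have hpA : (((15881 : ℕ) : ℤ)) ^ 0 = 1 := by norm_num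
    rintro i (rfl | hi')
    · rw [hP, hpA]; push_cast; omega
    · obtain ⟨k, hk⟩ := hl.odd_of_ne_two (by omega)
      have hl' : l = 2 * i + 3 := by omega
      subst hl'
      have hi0 : ((164639 : ℕ) : ℤ) ≤ (i : ℤ) := by exact_mod_cast (show 164639 ≤ i by omega)
      rw [hP, hpA]; push_cast at hi0 ⊢
      nlinarith [sq_nonneg (i : ℤ), mul_nonneg (sub_nonneg.mpr hi0) (show (0 : ℤ) ≤ (i : ℤ) by positivity)]
  · -- `p = 443077`: `v_443077(abc) = 1`, admissible `e = 15·l·n`, `A = 0`, shape tame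
    rw [factorization_triple_hex16.2.2.2.2.2.2.1] at h15 hodd ⊢
    have hA : 15 * l ∣ e := by simpa using h15
    obtain ⟨n, rfl⟩ := hA
    have hn : 1 ≤ n := Nat.pos_of_ne_zero (by rintro rfl; simp at he)
    refine ⟨WRow.natCast_ne_pow_mul_sub_one (by norm_num : Nat.Prime 5) (by norm_num) (by norm_num) (by norm_num)
      ⟨3 * l * n, by ring⟩, fun i hi => ?_⟩
    rw [if_neg (by norm_num : ¬ ((443077 : ℕ) ∣ 30 ∧ ¬ (443077 : ℕ) ∣ 1))]
    simp only [show ((443077 : ℕ) = 7) = False from eq_false (by decide), show ((443077 : ℕ) = 11) = False from eq_false (by decide), ite_false]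
    refine WRow.cell_tameslot_of_ends ((443077 : ℕ) : ℤ) (15 * l) (443077 - 1) 0 (2 * 1) (2 * l) 0 1 ((l - 1) / 2) 1 (by norm_num) (by norm_num)
      (by omega) (by omega) ⟨15, by ring⟩ (by omega) le_rfl ?_ hi hn
    have hP : 15 * l * (2 * 1) / (2 * l) = 15 := Nat.div_eq_of_eq_mul_left (by omega) (by ring)
    have hpA : (((443077 : ℕ) : ℤ)) ^ 0 = 1 := by norm_num
    rintro i (rfl | hi')
    · rw [hP, hpA]; push_cast; omega
    · obtain ⟨k, hk⟩ := hl.odd_of_ne_two (by omega)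
      have hl' : l = 2 * i + 3 := by omega
      subst hl'
      have hi0 : ((164639 : ℕ) : ℤ) ≤ (i : ℤ) := by exact_mod_cast (show 164639 ≤ i by omega)
      rw [hP, hpA]; push_cast at hi0 ⊢
      nlinarith [sq_nonneg (i : ℤ), mul_nonneg (sub_nonneg.mpr hi0) (show (0 : ℤ) ≤ (i : ℤ) by positivity)]
  · -- `p = 1153921`: `v_1153921(abc) = 1`, admissible `e = 15·l·n`, `A = 0`, shape tame
    rw [factorization_triple_hex16.2.2.2.2.2.2.2.1] at h15 hodd ⊢
    have hA : 15 * l ∣ e := by simpa using h15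
    obtain ⟨n, rfl⟩ := hA
    have hn : 1 ≤ n := Nat.pos_of_ne_zero (by rintro rfl; simp at he)
    refine ⟨WRow.natCast_ne_pow_mul_sub_one hl (by norm_num : Nat.Prime 1153921) (by omega)
      (WRow.not_dvd_1153921_sub_one_hex16 hl hl0) ⟨15 * n, by ring⟩, fun i hi => ?_⟩
    rw [if_neg (by norm_num : ¬ ((1153921 : ℕ) ∣ 30 ∧ ¬ (1153921 : ℕ) ∣ 1))]
    simp only [show ((1153921 : ℕ) = 7) = False from eq_false (by decide), show ((1153921 : ℕ) = 11) = False from eq_false (by decide), ite_false]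
    refine WRow.cell_tameslot_of_ends ((1153921 : ℕ) : ℤ) (15 * l) (1153921 - 1) 0 (2 * 1) (2 * l) 0 1 ((l - 1) / 2) 1 (by norm_num) (by norm_num)
      (by omega) (by omega) ⟨15, by ring⟩ (by omega) le_rfl ?_ hi hn
    have hP : 15 * l * (2 * 1) / (2 * l) = 15 := Nat.div_eq_of_eq_mul_left (by omega) (by ring)
    have hpA : (((1153921 : ℕ) : ℤ)) ^ 0 = 1 := by norm_num
    rintro i (rfl | hi')
    · rw [hP, hpA]; push_cast; omega
    · obtain ⟨k, hk⟩ := hl.odd_of_ne_two (by omega)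
      have hl' : l = 2 * i + 3 := by omega
      subst hl'
      have hi0 : ((164639 : ℕ) : ℤ) ≤ (i : ℤ) := by exact_mod_cast (show 164639 ≤ i by omega)
      rw [hP, hpA]; push_cast at hi0 ⊢
      nlinarith [sq_nonneg (i : ℤ), mul_nonneg (sub_nonneg.mpr hi0) (show (0 : ℤ) ≤ (i : ℤ) by positivity)]
  · -- `p = 5764799`: `v_5764799(abc) = 1`, admissible `e = 15·l·n`, `A = 0`, shape tame
    rw [factorization_triple_hex16.2.2.2.2.2.2.2.2] at h15 hodd ⊢
    have hA : 15 * l ∣ e := by simpa using h15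
    obtain ⟨n, rfl⟩ := hA
    have hn : 1 ≤ n := Nat.pos_of_ne_zero (by rintro rfl; simp at he)
    refine ⟨WRow.natCast_ne_pow_mul_sub_one (by norm_num : Nat.Prime 5) (by norm_num) (by norm_num) (by norm_num)
      ⟨3 * l * n, by ring⟩, fun i hi => ?_⟩
    rw [if_neg (by norm_num : ¬ ((5764799 : ℕ) ∣ 30 ∧ ¬ (5764799 : ℕ) ∣ 1))]
    simp only [show ((5764799 : ℕ) = 7) = False from eq_false (by decide), show ((5764799 : ℕ) = 11) = False from eq_false (by decide), ite_false]
    refine WRow.cell_tameslot_of_ends ((5764799 : ℕ) : ℤ) (15 * l) (5764799 - 1) 0 (2 * 1) (2 * l) 0 1 ((l - 1) / 2) 1 (by norm_num) (by norm_num)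
      (by omega) (by omega) ⟨15, by ring⟩ (by omega) le_rfl ?_ hi hn
    have hP : 15 * l * (2 * 1) / (2 * l) = 15 := Nat.div_eq_of_eq_mul_left (by omega) (by ring)
    have hpA : (((5764799 : ℕ) : ℤ)) ^ 0 = 1 := by norm_num
    rintro i (rfl | hi')
    · rw [hP, hpA]; push_cast; omega
    · obtain ⟨k, hk⟩ := hl.odd_of_ne_two (by omega)
      have hl' : l = 2 * i + 3 := by omega
      subst hl'
      have hi0 : ((164639 : ℕ) : ℤ) ≤ (i : ℤ) := by exact_mod_cast (show 164639 ≤ i by omega)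
      rw [hP, hpA]; push_cast at hi0 ⊢
      nlinarith [sq_nonneg (i : ℤ), mul_nonneg (sub_nonneg.mpr hi0) (show (0 : ℤ) ≤ (i : ℤ) by positivity)]

end Summit.ABC.IUTFork.Conditional

end
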